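import Literature.LinearAlgebra.Matrix.CrossInterpolation

/-!
# Venture HSemireg — MOD-4 line: the block assembly step of THEOREM R_f's middle degree
# (`rank [[α·1, Σ₁],[Σ₂, β·1]] = 2ⁿ + rank(αβ·1 − Σ₂Σ₁)` for `α ≠ 0`, any field, any block sizes)

HONEST FRAMING. Part of the Lean index of the computation cell `pub-hsemireg` (widening group W3, seat w3-mod4-1 gen 5;
files of record `HOME/widen/W3/MOD4-OFFSPLIT-w3mod4.md` §10.2 / §11 and `MOD4-THEOREM-RF-PROOF-w3mod4.md` v1.0 §4, §6).
LINEAR ALGEBRA OVER A FIELD ONLY: no abelian variety, no Hodge structure, no sheaf, no Ext group and no semiregularity map is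
constructed here; nothing here says that HC, HC_CM or HC_AV holds; no Literature fact is declared — the one Literature theorem
USED is the tree's PROVED Guttman rank additivity `Literature.LinearAlgebra.Matrix.rank_fromBlocks_eq_card_add_rank_schur`
([HornJohnson2013, §0.8.5 (b)]).  THEOREM R_f is NOT asserted here.
WHAT IS PROVED (kernel, 0 sorry).  In the proof sheet §4 the degree-`n` words living on one half of the sites give, in the
basis `(g_B)_B ⊔ (f_{B′})_{B′}` of `U` (`2ⁿ + 2ⁿ` vectors), the rows of the block matrix `[[α·1, Σ₁],[Σ₂, β·1]]`; the sheet
then reads off «since `α ≠ 0`: rank `= 2ⁿ + rank(β·1 − Σ₂α⁻¹Σ₁) = 2ⁿ + rank(αβ·1 − N)`, `N := Σ₂Σ₁`», and in the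
degenerate case `β = 0` (§6) «rank `= 2ⁿ + rank N`».  Here, for any field `K`, finite index types, `α ≠ 0`, any `β` and any
blocks `S₁ : m × k`, `S₂ : k × m`:
* `rank_fromBlocks_scalar` — `rank [[α·1, S₁],[S₂, β·1]] = |m| + rank((αβ)·1 − S₂S₁)`;
* `rank_fromBlocks_scalar_zero` — `β = 0`: `rank [[α·1, S₁],[S₂, 0]] = |m| + rank(S₂S₁)`;
* `card_eq_rank_add_finrank_ker` — bookkeeping `|k| = rank X + dim ker X` for the square matrix `X = (αβ)·1 − S₂S₁`, so that
  «`2ⁿ + rank(αβ·1 − N) = 2^{n+1} − dim ker(N − αβ)`» as used in §4 (with `Summit.Ventures.HSemireg.Mod4Site.finrank_ker_ZKZt`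
  of `Mod4SiteSigns.lean` for the further reduction `dim ker(N − λ) = dim ker(M_f − λ)`).
All statements and proofs: w3-mod4-1 g5 (2026-08-23).  Namespace `Summit.Ventures.HSemireg.Mod4Site`.
-/

namespace Summit.Ventures.HSemireg.Mod4Site

open Matrix

variable {K : Type*} [Field K] {m k : Type*} [Fintype m] [Fintype k] [DecidableEq m] [DecidableEq k]

/-- `(α·1)⁻¹ = α⁻¹·1` for `α ≠ 0`. -/
lemma inv_smul_one {α : K} (hα : α ≠ 0) : (α • (1 : Matrix m m K))⁻¹ = α⁻¹ • (1 : Matrix m m K) :=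
  Matrix.inv_eq_right_inv (by rw [smul_mul_smul_comm, mul_inv_cancel₀ hα, Matrix.mul_one, one_smul])

/-- a non-zero scalar does not change the rank: `rank(c·X) = rank X`. -/
lemma rank_smul_of_ne_zero {c : K} (hc : c ≠ 0) (X : Matrix k k K) : (c • X).rank = X.rank := by
  rw [show c • X = (c • (1 : Matrix k k K)) * X by rw [smul_mul_assoc, Matrix.one_mul]]
  refine Matrix.rank_mul_eq_right_of_isUnit_det _ _ ?_
  rw [Matrix.det_smul, Matrix.det_one, mul_one]
  exact (hc.isUnit.pow _)

/-- **BLOCK ASSEMBLY** (proof sheet §4): for `α ≠ 0`, `rank [[α·1, S₁],[S₂, β·1]] = |m| + rank((αβ)·1 − S₂S₁)`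
(Guttman rank additivity with the Schur complement `β·1 − S₂(α·1)⁻¹S₁ = α⁻¹·((αβ)·1 − S₂S₁)`). -/
theorem rank_fromBlocks_scalar {α : K} (hα : α ≠ 0) (β : K) (S₁ : Matrix m k K) (S₂ : Matrix k m K) :
    (fromBlocks (α • (1 : Matrix m m K)) S₁ S₂ (β • (1 : Matrix k k K))).rank =
      Fintype.card m + ((α * β) • (1 : Matrix k k K) - S₂ * S₁).rank := by
  have hdet : IsUnit (α • (1 : Matrix m m K)).det := by
    rw [Matrix.det_smul, Matrix.det_one, mul_one]; exact hα.isUnit.pow _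
  rw [Literature.LinearAlgebra.Matrix.rank_fromBlocks_eq_card_add_rank_schur _ _ _ _ hdet, inv_smul_one hα,
    Matrix.mul_smul, Matrix.mul_one, Matrix.smul_mul]
  congr 1
  rw [← rank_smul_of_ne_zero (inv_ne_zero hα) ((α * β) • (1 : Matrix k k K) - S₂ * S₁), smul_sub, smul_smul,
    ← mul_assoc, inv_mul_cancel₀ hα, one_mul]

/-- the degenerate case `β = 0` (proof sheet §6): `rank [[α·1, S₁],[S₂, 0]] = |m| + rank(S₂S₁)`. -/
theorem rank_fromBlocks_scalar_zero {α : K} (hα : α ≠ 0) (S₁ : Matrix m k K) (S₂ : Matrix k m K) :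
    (fromBlocks (α • (1 : Matrix m m K)) S₁ S₂ 0).rank = Fintype.card m + (S₂ * S₁).rank := by
  have h := rank_fromBlocks_scalar (m := m) (k := k) hα 0 S₁ S₂
  rw [zero_smul, mul_zero, zero_smul, zero_sub, ← neg_one_smul K (S₂ * S₁),
    rank_smul_of_ne_zero (neg_ne_zero.mpr one_ne_zero)] at h
  exact h

omit [DecidableEq k] in
/-- rank–nullity bookkeeping for a square matrix: `|k| = rank X + dim ker X` (so that
`2ⁿ + rank(αβ·1 − N) = 2^{n+1} − dim ker(N − αβ)` in the proof sheet §4). -/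
theorem card_eq_rank_add_finrank_ker (X : Matrix k k K) :
    Fintype.card k = X.rank + Module.finrank K (LinearMap.ker X.mulVecLin) := by
  rw [Matrix.rank, LinearMap.finrank_range_add_finrank_ker, Module.finrank_pi]

omit [DecidableEq k] in
/-- `ker(N − c) = ker(c − N)` bookkeeping: the kernel of `X` and of `−X` agree, for the sign convention of §4. -/
theorem finrank_ker_neg (X : Matrix k k K) :
    Module.finrank K (LinearMap.ker (-X).mulVecLin) = Module.finrank K (LinearMap.ker X.mulVecLin) := by
  have h : (-X).mulVecLin = -X.mulVecLin := by
    apply LinearMap.ext; intro v; simp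
  rw [h, LinearMap.ker_neg]

end Summit.Ventures.HSemireg.Mod4Site
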